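/-
Origin: expansion seat `prover-pub-hodgecm-mc-sinst-1-g11-0`, handover #1272 2026-08-21T03:59Z md5 f932eab95b0f (342 l.; NEW additive leaf, ns HodgeCM.Model.ThetaAdelicSide; imports the four AutG leaves #1265 #1267 #1269 #1271 + INSTALLED #1263 OfGPins; § 1 the three slot-file hypotheses DISCHARGED at η_k := etaT_k: etaT₀∕₁∕₂∕₃_V_rat (hη, hν ∕ hν' ⊢ ∀ v ∈ CMRat (frameD V), etaT_k … (v,1) = 1; etaT_k_apply_mk_one) and etaT₀∕₁∕₂∕₃_W_rat (⊢ ∀ t₀ ∈ relNormOneRat, etaT_k … (1, ũ_t₀) = 1; etaT_k_eq_one_of_rat); § 2 at S := archSideOfT' V c hGR hGR₀ hGR₁ hGR₂ hGR₃ η hη hηc ν hν hνc ν' hν' hν'c h₁W AT' (hω := rfl, hι := rfl, hη_kc := continuous_etaT_k): def dictEquivZero∕One∕Two∕ThreeCanonicalT' : Ω(splitLine_k ⊗ ĉ_k(etaT_k), χ″_k) ≃ₗ[adelicAlgebra V] ((thetaDistDatum_kOfT' … Φarch harm hdef).coinvRep χ).asModule (#1263 datum) + _surjective; isAutChar_charZero∕One∕Two∕ThreeDictG_T'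 (hχinf) — only the archimedean identity left; cert rc 0 ∕ 93 s, 0 warn ∕ 0 proof-hole; NAMES for audit: HodgeCM.Model.ThetaAdelicSide.etaT₀_V_rat · HodgeCM.Model.ThetaAdelicSide.dictEquivOneCanonicalT'_surjective · HodgeCM.Model.ThetaAdelicSide.isAutChar_charOneDictG_T') (`HOME/mc/pub-hodgecm-mc-sinst-1-g11/stage70/HodgeCM/Model/AdelicThetaSlotPinsR2.lean`, md5 f932eab95b0f, 342 lines);
landed by the gen-30 packager (p-g30) in gate run 71 as `HodgeCM/Model/AdelicThetaSlotPinsR2.lean` (verbatim).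
-/
/-
Copyright (c) 2026 the pub-hodgecm formalisation cell (harness21).  New file, not vendored.
Origin: session prover-pub-hodgecm-mc-sinst-1-g11-0 (unit pub-hodgecm-mc-sinst-1-g11, S-INSTANCE CONSTRUCTOR gen 11; the R2-PIN READ-BACKS of the
slot-generic (J4) bridge + SEAM-AUT files: the slot characters `η₀∕η₁ := etaT₀∕etaT₁ η ν`, `η₂∕η₃ := etaT₂∕etaT₃ η ν′` of the doubly twisted
term `archSideOfT'` (the side of the pin of record `SInstance.SROGT'C`, lead 1-g84 ROUTING WORD 2026-08-21T02:34:03Z) satisfy the three hypotheses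
`hη_kc ∕ hη_kV ∕ hη_kW` by carch ∕ period-1's `continuous_etaT_k`, `etaT_k_apply_mk_one`, `etaT_k_eq_one_of_rat`), 2026-08-21.
Intended final place: `HodgeCM/Model/AdelicThetaSlotPinsR2.lean` (NEW additive model-layer leaf; imports the four sinst-1 SEAM-AUT leaves
`Model/AdelicThetaSlot{Zero,One,Two,Three}AutG` and #1263 `Model/AdelicThetaDistributionOfGPins`; nothing imports it; drop alone).
-/
import Summits.HodgeConjecture.HodgeCM.Model.AdelicThetaSlotZeroAutG
import Summits.HodgeConjecture.HodgeCM.Model.AdelicThetaSlotOneAutG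
import Summits.HodgeConjecture.HodgeCM.Model.AdelicThetaSlotTwoAutG
import Summits.HodgeConjecture.HodgeCM.Model.AdelicThetaSlotThreeAutG
import Summits.HodgeConjecture.HodgeCM.Model.AdelicThetaDistributionOfGPins

set_option autoImplicit false

/-!
# The four slots at the R2 pin `archSideOfT' … η ν ν′ …`: hypotheses discharged, dictionary carriers and `IsAutChar` read back

§ 1 For the doubly twisted slot characters `η₀' := etaT₀ η ν`, `η₁' := etaT₁ η ν`, `η₂' := etaT₂ η ν′`, `η₃' := etaT₃ η ν′`
(`Model/ArchSideOfTwist`, `Model/ArchSideOfTwist34`) and the pin hypotheses `hη`, `hν`, `hν′` (rationality):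
* `etaT_k_V_rat : ∀ v ∈ CMRat (frameD V), η_k' (v, 1) = 1` (the `hη_kV` of `bigChar…_isRatTrivial`);
* `etaT_k_W_rat : ∀ t₀ ∈ relNormOneRat, η_k' (1, ũ_{t₀}) = 1` (the `hη_kW` of `isAutChar_char…DictG`).
§ 2 At `S := archSideOfT' …` (`hω := rfl`, `hι := rfl`, `hη_kc := continuous_etaT_k … hηc hνc ∕ hν′c`), for each slot `k`:
* **`dictEquiv…CanonicalT'`** `: Ω(splitLine_k ⊗ ĉ_k(η_k'), χ″_k) ≃ₗ[ℂ[U(V)(𝔸_f)]] (D_k.coinvRep χ).asModule` at the #1263 datum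
  `D_k := thetaDistDatum…OfT' … Φarch harm hdef` + `_surjective` — binder-2's block socket input at the pin of record;
* **`isAutChar_char…DictG_T' (hχinf)`** — the dictionary character is a `GoodChar` of the twisted record modulo the ONE archimedean identity
  `hχinf` of the slot (carch (CC_k) ∕ theta-3 `hasCentralTypeAt_twistBy_iff` supply it on the weight set).
KERNEL only: 0 records, 0 `def … : Prop`, nothing cited as a hypothesis; `#print axioms` ⊆ {propext, Classical.choice, Quot.sound}.
-/

noncomputable section

open MulAction IsDedekindDomain NumberField.mixedEmbedding
open NumberField hiding relNormOneIdeles relNormOneRat probHaarRelNormOneQuot relNormOneInfUnits relNormOneInfToIdeles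
open scoped Matrix TensorProduct Classical SchwartzMap
open Literature.NumberTheory.Automorphic Literature.NumberTheory.Weil1964
open Literature.NumberTheory.GelbartRogawski1991 Literature.NumberTheory.GelbartRogawski1991.UnitaryDualPair
open Literature.Geometry.ComplexHyperbolic.BallModel (U21 x₀)
open Literature.AlgebraicGeometry.ShimuraVarieties
open HodgeCM.Adelic HodgeCM.PerL34 HodgeCM.Model.ArchSideTerm HodgeCM.Model.ThetaDistFin
open Literature.NumberTheory.Automorphic.UnitaryGroup (cmAdelicOneEquivRelNormOne)

namespace HodgeCM.Model
namespace ThetaAdelicSide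

variable {L : CMField} {ι₁ : L →+* ℂ} (V : HermSpace3 L ι₁) (c : SeesawCtx L)
  (hGR : (cmSplittingDatum (L : Type) finProdFinEquiv (frameD V) (frameD_real V) (frameD_ne V) (dW c.D) (dW_real c.D)
    (dW_ne c.D)).CompatibleSplitting)
  (hGR₀ : (cmSplittingDatum (L : Type) (e₁) (frameD V) (frameD_real V) (frameD_ne V) (lineVec (L : Type) (dW c.D 0))
    (fun _ => dW_real c.D 0) (fun _ => dW_ne c.D 0)).CompatibleSplitting)
  (hGR₁ : (cmSplittingDatum (L : Type) (e₁) (frameD V) (frameD_real V) (frameD_ne V) (lineVec (L : Type) (dW c.D 1))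
    (fun _ => dW_real c.D 1) (fun _ => dW_ne c.D 1)).CompatibleSplitting)
  (hGR₂ : (cmSplittingDatum (L : Type) (e₁) (frameD V) (frameD_real V) (frameD_ne V) (lineVec (L : Type) (dW' c.D 0))
    (fun _ => dW'_real c.D 0) (fun _ => dW'_ne c.D 0)).CompatibleSplitting)
  (hGR₃ : (cmSplittingDatum (L : Type) (e₁) (frameD V) (frameD_real V) (frameD_ne V) (lineVec (L : Type) (dW' c.D 1))
    (fun _ => dW'_real c.D 1) (fun _ => dW'_ne c.D 1)).CompatibleSplitting)
  (η : CMAdelic (L : Type) (frameD V) × CMAdelic (L : Type) (dW c.D) →* ℂˣ)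
  (hη : ∀ γU ∈ CMRat (L : Type) (frameD V), ∀ γ ∈ CMRat (L : Type) (dW c.D), η (γU, γ) = 1)
  (hηc : Continuous fun p => ((η p : ℂˣ) : ℂ))
  (ν : CMAdelic (L : Type) (frameD V) →* ℂˣ)
  (hν : ∀ γU ∈ CMRat (L : Type) (frameD V), ν γU = 1)
  (hνc : Continuous fun v => ((ν v : ℂˣ) : ℂ))
  (ν' : CMAdelic (L : Type) (frameD V) →* ℂˣ)
  (hν' : ∀ γU ∈ CMRat (L : Type) (frameD V), ν' γU = 1)
  (hν'c : Continuous fun v => ((ν' v : ℂˣ) : ℂ))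
  (h₁W : (∀ j, 0 < (ι₁ (dW c.D j)).re) ∨ ∀ j, (ι₁ (dW c.D j)).re < 0)
  (hV : IsAnisotropic L V.Hm)

/-! ## § 1. The three hypotheses of the slot files at `η_k := etaT_k` -/

include hη hν in
/-- `η₀'(v, 1) = ν(v)⁻¹ · η(v, 1) = 1` on `U(diag frameD V)(L⁺)`. -/
theorem etaT₀_V_rat : ∀ v ∈ CMRat (L : Type) (frameD V), etaT₀ V c.D η ν (v, 1) = 1 := fun v hv => by
  rw [etaT₀_apply_mk_one, hν v hv, inv_one, one_mul]
  exact hη v hv 1 (one_mem _)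

include hν in
/-- `η₁'(v, 1) = ν(v) = 1` on `U(diag frameD V)(L⁺)`. -/
theorem etaT₁_V_rat : ∀ v ∈ CMRat (L : Type) (frameD V), etaT₁ V c.D η ν (v, 1) = 1 := fun v hv => by
  rw [etaT₁_apply_mk_one]
  exact hν v hv

include hη hν' in
/-- `η₂'(v, 1) = ν′(v)⁻¹ · η(v, 1) = 1` on `U(diag frameD V)(L⁺)`. -/
theorem etaT₂_V_rat : ∀ v ∈ CMRat (L : Type) (frameD V), etaT₂ V c.D η ν' (v, 1) = 1 := fun v hv => by
  rw [etaT₂_apply_mk_one, hν' v hv, inv_one, one_mul]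
  exact hη v hv 1 (one_mem _)

include hν' in
/-- `η₃'(v, 1) = ν′(v) = 1` on `U(diag frameD V)(L⁺)`. -/
theorem etaT₃_V_rat : ∀ v ∈ CMRat (L : Type) (frameD V), etaT₃ V c.D η ν' (v, 1) = 1 := fun v hv => by
  rw [etaT₃_apply_mk_one]
  exact hν' v hv

include hη hν in
/-- `η₀'(1, ũ_{t₀}) = 1` for rational `t₀`. -/
theorem etaT₀_W_rat : ∀ t₀ ∈ relNormOneRat (↥(maximalRealSubfield L)) L, etaT₀ V c.D η ν (1, (cmAdelicOneEquivRelNormOne (L : Type)).symm t₀) = 1 :=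
  fun _ ht₀ => etaT₀_eq_one_of_rat V c.D η ν hη hν (one_mem _) ht₀

include hη hν in
/-- `η₁'(1, ũ_{t₀}) = 1` for rational `t₀`. -/
theorem etaT₁_W_rat : ∀ t₀ ∈ relNormOneRat (↥(maximalRealSubfield L)) L, etaT₁ V c.D η ν (1, (cmAdelicOneEquivRelNormOne (L : Type)).symm t₀) = 1 :=
  fun _ ht₀ => etaT₁_eq_one_of_rat V c.D η ν hη hν (one_mem _) ht₀

include hη hν' in
/-- `η₂'(1, ũ_{t₀}) = 1` for rational `t₀`. -/
theorem etaT₂_W_rat :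
    ∀ t₀ ∈ relNormOneRat (↥(maximalRealSubfield L)) L, etaT₂ V c.D η ν' (1, (cmAdelicOneEquivRelNormOne (L : Type)).symm t₀) = 1 :=
  fun _ ht₀ => etaT₂_eq_one_of_rat V c.D η ν' hη hν' (one_mem _) ht₀

include hη hν' in
/-- `η₃'(1, ũ_{t₀}) = 1` for rational `t₀`. -/
theorem etaT₃_W_rat :
    ∀ t₀ ∈ relNormOneRat (↥(maximalRealSubfield L)) L, etaT₃ V c.D η ν' (1, (cmAdelicOneEquivRelNormOne (L : Type)).symm t₀) = 1 :=
  fun _ ht₀ => etaT₃_eq_one_of_rat V c.D η ν' hη hν' (one_mem _) ht₀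

/-! ## § 2. The four slots at `S := archSideOfT' …` -/

section Pin

variable (AT' : ∀ k : Fin 4, ArchLineInput V (lineRepT' V c.D hGR hGR₀ hGR₁ hGR₂ hGR₃ η ν ν' k))

/-- **SLOT 0 AT THE R2 PIN, CANONICAL FORM**: `Ω(splitLineZero ⊗ ĉ₀(η₀'), χ″₀) ≃ₗ[ℂ[U(V)(𝔸_f)]] Ω₀(χ)` at the #1263 datum
`thetaDistDatumZeroOfT'`. -/
def dictEquivZeroCanonicalT' (Φarch : Module.Dual ℂ (Fin 2 → ℂ) →ₗ[ℂ] 𝓢((Fin 3 → mixedSpace (↥(maximalRealSubfield L))), ℂ))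
    (harm : ∀ (u : ↥(stabilizer U21 x₀)) (ℓ : Module.Dual ℂ (Fin 2 → ℂ)),
      lineOmega_zero V c.D hGR hGR₀ hGR₁ (etaT₀ V c.D η ν) (u : U21) (Φarch ℓ) =
        Φarch ((BallForms.isPullbackCocycle_cotangentCocycle.weightOf x₀).dual u ℓ))
    (hdef : ∀ a : UnitaryGroup.arch (↥(maximalRealSubfield L)) L (IsCMField.complexConj L) 3 V.Hm,
      UnitaryGroup.archAt (↥(maximalRealSubfield L)) L (IsCMField.complexConj L) 3 V.Hm (UnitaryGroup.cmPlace (L : Type) ι₁)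
          (NumberField.complexConj_smul_infinitePlace (L : Type) _) (IsCMField.complexConj_ne_one (L : Type)) a = 1 →
      ∀ (ℓ : Module.Dual ℂ (Fin 2 → ℂ)) (Φf : FinSB (↥(maximalRealSubfield L)) (Fin 3)),
        lineRepOf V c.D hGR hGR₀ hGR₁ hGR₂ hGR₃ (etaT₀ V c.D η ν) (etaT₁ V c.D η ν) (etaT₂ V c.D η ν') (etaT₃ V c.D η ν') 0
            (HodgeCM.Adelic.regimeEquiv L V.Hm hV
              (UnitaryGroup.archToAdelic (↥(maximalRealSubfield L)) L (IsCMField.complexConj L) 3 V.Hm a), 1)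
            (piSchwartzBruhatEquiv (↥(maximalRealSubfield L)) (Fin 3) (Φarch ℓ ⊗ₜ[ℂ] Φf)) =
          piSchwartzBruhatEquiv (↥(maximalRealSubfield L)) (Fin 3) (Φarch ℓ ⊗ₜ[ℂ] Φf))
    (χ : PontryaginDual (↥(relNormOneIdeles (↥(maximalRealSubfield L)) L) ⧸ relNormOneRat (↥(maximalRealSubfield L)) L)) :
    (splitLineZeroTwistedG V c hGR hGR₀ hGR₁ (etaT₀ V c.D η ν) (etaT₀_V_rat V c η hη ν hν)).Ω
        (finFrameCongr (L : Type) V.Hm (frameG V) (frameD V) (frame_congr V)) (charZeroDictG V c hGR hGR₀ hGR₁ (etaT₀ V c.D η ν) χ) ≃ₗ[adelicAlgebra V]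
      ((thetaDistDatumZeroOfT' V c hGR hGR₀ hGR₁ hGR₂ hGR₃ h₁W hV η hη hηc ν hν hνc ν' hν' hν'c AT' Φarch harm hdef).coinvRep χ).asModule :=
  dictEquivZeroCanonicalG V c (archSideOfT' V c hGR hGR₀ hGR₁ hGR₂ hGR₃ η hη hηc ν hν hνc ν' hν' hν'c h₁W AT') hGR hGR₀ hGR₁ hGR₂ hGR₃ (etaT₀ V c.D η ν) (etaT₁ V c.D η ν) (etaT₂ V c.D η ν') (etaT₃ V c.D η ν') rfl h₁W hV rfl (continuous_etaT₀ V c.D η ν hηc hνc) (etaT₀_V_rat V c η hη ν hν) Φarch harm hdef χ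

/-- hence the surjection binder-2's block socket consumes, slot 0, pin R2. -/
theorem dictEquivZeroCanonicalT'_surjective (Φarch : Module.Dual ℂ (Fin 2 → ℂ) →ₗ[ℂ] 𝓢((Fin 3 → mixedSpace (↥(maximalRealSubfield L))), ℂ))
    (harm : ∀ (u : ↥(stabilizer U21 x₀)) (ℓ : Module.Dual ℂ (Fin 2 → ℂ)),
      lineOmega_zero V c.D hGR hGR₀ hGR₁ (etaT₀ V c.D η ν) (u : U21) (Φarch ℓ) =
        Φarch ((BallForms.isPullbackCocycle_cotangentCocycle.weightOf x₀).dual u ℓ))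
    (hdef : ∀ a : UnitaryGroup.arch (↥(maximalRealSubfield L)) L (IsCMField.complexConj L) 3 V.Hm,
      UnitaryGroup.archAt (↥(maximalRealSubfield L)) L (IsCMField.complexConj L) 3 V.Hm (UnitaryGroup.cmPlace (L : Type) ι₁)
          (NumberField.complexConj_smul_infinitePlace (L : Type) _) (IsCMField.complexConj_ne_one (L : Type)) a = 1 →
      ∀ (ℓ : Module.Dual ℂ (Fin 2 → ℂ)) (Φf : FinSB (↥(maximalRealSubfield L)) (Fin 3)),
        lineRepOf V c.D hGR hGR₀ hGR₁ hGR₂ hGR₃ (etaT₀ V c.D η ν) (etaT₁ V c.D η ν) (etaT₂ V c.D η ν') (etaT₃ V c.D η ν') 0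
            (HodgeCM.Adelic.regimeEquiv L V.Hm hV
              (UnitaryGroup.archToAdelic (↥(maximalRealSubfield L)) L (IsCMField.complexConj L) 3 V.Hm a), 1)
            (piSchwartzBruhatEquiv (↥(maximalRealSubfield L)) (Fin 3) (Φarch ℓ ⊗ₜ[ℂ] Φf)) =
          piSchwartzBruhatEquiv (↥(maximalRealSubfield L)) (Fin 3) (Φarch ℓ ⊗ₜ[ℂ] Φf))
    (χ : PontryaginDual (↥(relNormOneIdeles (↥(maximalRealSubfield L)) L) ⧸ relNormOneRat (↥(maximalRealSubfield L)) L)) :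
    Function.Surjective
      (dictEquivZeroCanonicalT' V c hGR hGR₀ hGR₁ hGR₂ hGR₃ η hη hηc ν hν hνc ν' hν' hν'c h₁W hV AT' Φarch harm hdef χ) :=
  (dictEquivZeroCanonicalT' V c hGR hGR₀ hGR₁ hGR₂ hGR₃ η hη hηc ν hν hνc ν' hν' hν'c h₁W hV AT' Φarch harm hdef χ).surjective

include hη hηc hνc h₁W in
/-- **`χ″₀(η₀', χ)` IS A `GoodChar` OF THE TWISTED SLOT-0 RECORD AT THE R2 PIN** modulo the one archimedean identity `hχinf`. -/
theorem isAutChar_charZeroDictG_T'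
    (χ : PontryaginDual (↥(relNormOneIdeles (↥(maximalRealSubfield L)) L) ⧸ relNormOneRat (↥(maximalRealSubfield L)) L))
    (hχinf : ∀ t : ↥(relNormOneInfUnits (↥(maximalRealSubfield L)) L),
      ((χ (QuotientGroup.mk (relNormOneInfToIdeles (↥(maximalRealSubfield L)) L t)) : Circle) : ℂ) *
          ((torusScalar_zeroG V c.D hGR hGR₀ hGR₁ (etaT₀ V c.D η ν)
            ((cmAdelicOneEquivRelNormOne (L : Type)).symm (relNormOneInfToIdeles (↥(maximalRealSubfield L)) L t)) : ℂˣ) : ℂ) =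
        ((adelicCharZeroG V c hGR hGR₀ hGR₁ (etaT₀ V c.D η ν) (CMCenter (L : Type) (frameD V)
            ((cmAdelicOneEquivRelNormOne (L : Type)).symm (relNormOneInfToIdeles (↥(maximalRealSubfield L)) L t))) : ℂˣ) : ℂ)) :
    (splitLineZeroTwistedG V c hGR hGR₀ hGR₁ (etaT₀ V c.D η ν) (etaT₀_V_rat V c η hη ν hν)).IsAutChar (charZeroDictG V c hGR hGR₀ hGR₁ (etaT₀ V c.D η ν) χ) :=
  isAutChar_charZeroDictG V c hGR hGR₀ hGR₁ (etaT₀ V c.D η ν) (continuous_etaT₀ V c.D η ν hηc hνc) (etaT₀_V_rat V c η hη ν hν) (etaT₀_W_rat V c η hη ν hν) h₁W χ hχinf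

/-- **SLOT 1 AT THE R2 PIN, CANONICAL FORM**: `Ω(splitLineOne ⊗ ĉ₁(η₁'), χ″₁) ≃ₗ[ℂ[U(V)(𝔸_f)]] Ω₁(χ)` at the #1263 datum
`thetaDistDatumOneOfT'`. -/
def dictEquivOneCanonicalT' (Φarch : Module.Dual ℂ (Fin 2 → ℂ) →ₗ[ℂ] 𝓢((Fin 3 → mixedSpace (↥(maximalRealSubfield L))), ℂ))
    (harm : ∀ (u : ↥(stabilizer U21 x₀)) (ℓ : Module.Dual ℂ (Fin 2 → ℂ)),
      lineOmega_one V c.D hGR hGR₀ hGR₁ (etaT₁ V c.D η ν) (u : U21) (Φarch ℓ) =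
        Φarch ((BallForms.isPullbackCocycle_cotangentCocycle.weightOf x₀).dual u ℓ))
    (hdef : ∀ a : UnitaryGroup.arch (↥(maximalRealSubfield L)) L (IsCMField.complexConj L) 3 V.Hm,
      UnitaryGroup.archAt (↥(maximalRealSubfield L)) L (IsCMField.complexConj L) 3 V.Hm (UnitaryGroup.cmPlace (L : Type) ι₁)
          (NumberField.complexConj_smul_infinitePlace (L : Type) _) (IsCMField.complexConj_ne_one (L : Type)) a = 1 →
      ∀ (ℓ : Module.Dual ℂ (Fin 2 → ℂ)) (Φf : FinSB (↥(maximalRealSubfield L)) (Fin 3)),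
        lineRepOf V c.D hGR hGR₀ hGR₁ hGR₂ hGR₃ (etaT₀ V c.D η ν) (etaT₁ V c.D η ν) (etaT₂ V c.D η ν') (etaT₃ V c.D η ν') 1
            (HodgeCM.Adelic.regimeEquiv L V.Hm hV
              (UnitaryGroup.archToAdelic (↥(maximalRealSubfield L)) L (IsCMField.complexConj L) 3 V.Hm a), 1)
            (piSchwartzBruhatEquiv (↥(maximalRealSubfield L)) (Fin 3) (Φarch ℓ ⊗ₜ[ℂ] Φf)) =
          piSchwartzBruhatEquiv (↥(maximalRealSubfield L)) (Fin 3) (Φarch ℓ ⊗ₜ[ℂ] Φf))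
    (χ : PontryaginDual (↥(relNormOneIdeles (↥(maximalRealSubfield L)) L) ⧸ relNormOneRat (↥(maximalRealSubfield L)) L)) :
    (splitLineOneTwistedG V c hGR hGR₀ hGR₁ (etaT₁ V c.D η ν) (etaT₁_V_rat V c η ν hν)).Ω
        (finFrameCongr (L : Type) V.Hm (frameG V) (frameD V) (frame_congr V)) (charOneDictG V c hGR hGR₀ hGR₁ (etaT₁ V c.D η ν) χ) ≃ₗ[adelicAlgebra V]
      ((thetaDistDatumOneOfT' V c hGR hGR₀ hGR₁ hGR₂ hGR₃ h₁W hV η hη hηc ν hν hνc ν' hν' hν'c AT' Φarch harm hdef).coinvRep χ).asModule :=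
  dictEquivOneCanonicalG V c (archSideOfT' V c hGR hGR₀ hGR₁ hGR₂ hGR₃ η hη hηc ν hν hνc ν' hν' hν'c h₁W AT') hGR hGR₀ hGR₁ hGR₂ hGR₃ (etaT₀ V c.D η ν) (etaT₁ V c.D η ν) (etaT₂ V c.D η ν') (etaT₃ V c.D η ν') rfl hV rfl (continuous_etaT₁ V c.D η ν hηc hνc) (etaT₁_V_rat V c η ν hν) Φarch harm hdef χ

/-- hence the surjection binder-2's block socket consumes, slot 1, pin R2. -/
theorem dictEquivOneCanonicalT'_surjective (Φarch : Module.Dual ℂ (Fin 2 → ℂ) →ₗ[ℂ] 𝓢((Fin 3 → mixedSpace (↥(maximalRealSubfield L))), ℂ))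
    (harm : ∀ (u : ↥(stabilizer U21 x₀)) (ℓ : Module.Dual ℂ (Fin 2 → ℂ)),
      lineOmega_one V c.D hGR hGR₀ hGR₁ (etaT₁ V c.D η ν) (u : U21) (Φarch ℓ) =
        Φarch ((BallForms.isPullbackCocycle_cotangentCocycle.weightOf x₀).dual u ℓ))
    (hdef : ∀ a : UnitaryGroup.arch (↥(maximalRealSubfield L)) L (IsCMField.complexConj L) 3 V.Hm,
      UnitaryGroup.archAt (↥(maximalRealSubfield L)) L (IsCMField.complexConj L) 3 V.Hm (UnitaryGroup.cmPlace (L : Type) ι₁)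
          (NumberField.complexConj_smul_infinitePlace (L : Type) _) (IsCMField.complexConj_ne_one (L : Type)) a = 1 →
      ∀ (ℓ : Module.Dual ℂ (Fin 2 → ℂ)) (Φf : FinSB (↥(maximalRealSubfield L)) (Fin 3)),
        lineRepOf V c.D hGR hGR₀ hGR₁ hGR₂ hGR₃ (etaT₀ V c.D η ν) (etaT₁ V c.D η ν) (etaT₂ V c.D η ν') (etaT₃ V c.D η ν') 1
            (HodgeCM.Adelic.regimeEquiv L V.Hm hV
              (UnitaryGroup.archToAdelic (↥(maximalRealSubfield L)) L (IsCMField.complexConj L) 3 V.Hm a), 1)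
            (piSchwartzBruhatEquiv (↥(maximalRealSubfield L)) (Fin 3) (Φarch ℓ ⊗ₜ[ℂ] Φf)) =
          piSchwartzBruhatEquiv (↥(maximalRealSubfield L)) (Fin 3) (Φarch ℓ ⊗ₜ[ℂ] Φf))
    (χ : PontryaginDual (↥(relNormOneIdeles (↥(maximalRealSubfield L)) L) ⧸ relNormOneRat (↥(maximalRealSubfield L)) L)) :
    Function.Surjective
      (dictEquivOneCanonicalT' V c hGR hGR₀ hGR₁ hGR₂ hGR₃ η hη hηc ν hν hνc ν' hν' hν'c h₁W hV AT' Φarch harm hdef χ) :=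
  (dictEquivOneCanonicalT' V c hGR hGR₀ hGR₁ hGR₂ hGR₃ η hη hηc ν hν hνc ν' hν' hν'c h₁W hV AT' Φarch harm hdef χ).surjective

include hη hηc hνc h₁W in
/-- **`χ″₁(η₁', χ)` IS A `GoodChar` OF THE TWISTED SLOT-1 RECORD AT THE R2 PIN** modulo the one archimedean identity `hχinf`. -/
theorem isAutChar_charOneDictG_T'
    (χ : PontryaginDual (↥(relNormOneIdeles (↥(maximalRealSubfield L)) L) ⧸ relNormOneRat (↥(maximalRealSubfield L)) L))
    (hχinf : ∀ t : ↥(relNormOneInfUnits (↥(maximalRealSubfield L)) L),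
      ((χ (QuotientGroup.mk (relNormOneInfToIdeles (↥(maximalRealSubfield L)) L t)) : Circle) : ℂ) *
          ((torusScalar_oneG V c.D hGR hGR₀ hGR₁ (etaT₁ V c.D η ν)
            ((cmAdelicOneEquivRelNormOne (L : Type)).symm (relNormOneInfToIdeles (↥(maximalRealSubfield L)) L t)) : ℂˣ) : ℂ) =
        ((adelicCharOne V c hGR hGR₀ hGR₁ (etaT₁ V c.D η ν) (CMCenter (L : Type) (frameD V)
            ((cmAdelicOneEquivRelNormOne (L : Type)).symm (relNormOneInfToIdeles (↥(maximalRealSubfield L)) L t))) : ℂˣ) : ℂ)) :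
    (splitLineOneTwistedG V c hGR hGR₀ hGR₁ (etaT₁ V c.D η ν) (etaT₁_V_rat V c η ν hν)).IsAutChar (charOneDictG V c hGR hGR₀ hGR₁ (etaT₁ V c.D η ν) χ) :=
  isAutChar_charOneDictG V c hGR hGR₀ hGR₁ (etaT₁ V c.D η ν) (continuous_etaT₁ V c.D η ν hηc hνc) (etaT₁_V_rat V c η ν hν) (etaT₁_W_rat V c η hη ν hν) h₁W χ hχinf

/-- **SLOT 2 AT THE R2 PIN, CANONICAL FORM**: `Ω(splitLineTwo ⊗ ĉ₂(η₂'), χ″₂) ≃ₗ[ℂ[U(V)(𝔸_f)]] Ω₂(χ)` at the #1263 datum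
`thetaDistDatumTwoOfT'`. -/
def dictEquivTwoCanonicalT' (Φarch : Module.Dual ℂ (Fin 2 → ℂ) →ₗ[ℂ] 𝓢((Fin 3 → mixedSpace (↥(maximalRealSubfield L))), ℂ))
    (harm : ∀ (u : ↥(stabilizer U21 x₀)) (ℓ : Module.Dual ℂ (Fin 2 → ℂ)),
      lineOmega_two V c.D hGR hGR₂ hGR₃ (etaT₂ V c.D η ν') (u : U21) (Φarch ℓ) =
        Φarch ((BallForms.isPullbackCocycle_cotangentCocycle.weightOf x₀).dual u ℓ))
    (hdef : ∀ a : UnitaryGroup.arch (↥(maximalRealSubfield L)) L (IsCMField.complexConj L) 3 V.Hm,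
      UnitaryGroup.archAt (↥(maximalRealSubfield L)) L (IsCMField.complexConj L) 3 V.Hm (UnitaryGroup.cmPlace (L : Type) ι₁)
          (NumberField.complexConj_smul_infinitePlace (L : Type) _) (IsCMField.complexConj_ne_one (L : Type)) a = 1 →
      ∀ (ℓ : Module.Dual ℂ (Fin 2 → ℂ)) (Φf : FinSB (↥(maximalRealSubfield L)) (Fin 3)),
        lineRepOf V c.D hGR hGR₀ hGR₁ hGR₂ hGR₃ (etaT₀ V c.D η ν) (etaT₁ V c.D η ν) (etaT₂ V c.D η ν') (etaT₃ V c.D η ν') 2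
            (HodgeCM.Adelic.regimeEquiv L V.Hm hV
              (UnitaryGroup.archToAdelic (↥(maximalRealSubfield L)) L (IsCMField.complexConj L) 3 V.Hm a), 1)
            (piSchwartzBruhatEquiv (↥(maximalRealSubfield L)) (Fin 3) (Φarch ℓ ⊗ₜ[ℂ] Φf)) =
          piSchwartzBruhatEquiv (↥(maximalRealSubfield L)) (Fin 3) (Φarch ℓ ⊗ₜ[ℂ] Φf))
    (χ : PontryaginDual (↥(relNormOneIdeles (↥(maximalRealSubfield L)) L) ⧸ relNormOneRat (↥(maximalRealSubfield L)) L)) :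
    (splitLineTwoTwistedG V c hGR hGR₂ hGR₃ (etaT₂ V c.D η ν') (etaT₂_V_rat V c η hη ν' hν')).Ω
        (finFrameCongr (L : Type) V.Hm (frameG V) (frameD V) (frame_congr V)) (charTwoDictG V c hGR hGR₂ hGR₃ (etaT₂ V c.D η ν') χ) ≃ₗ[adelicAlgebra V]
      ((thetaDistDatumTwoOfT' V c hGR hGR₀ hGR₁ hGR₂ hGR₃ h₁W hV η hη hηc ν hν hνc ν' hν' hν'c AT' Φarch harm hdef).coinvRep χ).asModule :=
  dictEquivTwoCanonicalG V c (archSideOfT' V c hGR hGR₀ hGR₁ hGR₂ hGR₃ η hη hηc ν hν hνc ν' hν' hν'c h₁W AT') hGR hGR₀ hGR₁ hGR₂ hGR₃ (etaT₀ V c.D η ν) (etaT₁ V c.D η ν) (etaT₂ V c.D η ν') (etaT₃ V c.D η ν') rfl h₁W hV rfl (continuous_etaT₂ V c.D η ν' hηc hν'c) (etaT₂_V_rat V c η hη ν' hν') Φarch harm hdef χ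

/-- hence the surjection binder-2's block socket consumes, slot 2, pin R2. -/
theorem dictEquivTwoCanonicalT'_surjective (Φarch : Module.Dual ℂ (Fin 2 → ℂ) →ₗ[ℂ] 𝓢((Fin 3 → mixedSpace (↥(maximalRealSubfield L))), ℂ))
    (harm : ∀ (u : ↥(stabilizer U21 x₀)) (ℓ : Module.Dual ℂ (Fin 2 → ℂ)),
      lineOmega_two V c.D hGR hGR₂ hGR₃ (etaT₂ V c.D η ν') (u : U21) (Φarch ℓ) =
        Φarch ((BallForms.isPullbackCocycle_cotangentCocycle.weightOf x₀).dual u ℓ))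
    (hdef : ∀ a : UnitaryGroup.arch (↥(maximalRealSubfield L)) L (IsCMField.complexConj L) 3 V.Hm,
      UnitaryGroup.archAt (↥(maximalRealSubfield L)) L (IsCMField.complexConj L) 3 V.Hm (UnitaryGroup.cmPlace (L : Type) ι₁)
          (NumberField.complexConj_smul_infinitePlace (L : Type) _) (IsCMField.complexConj_ne_one (L : Type)) a = 1 →
      ∀ (ℓ : Module.Dual ℂ (Fin 2 → ℂ)) (Φf : FinSB (↥(maximalRealSubfield L)) (Fin 3)),
        lineRepOf V c.D hGR hGR₀ hGR₁ hGR₂ hGR₃ (etaT₀ V c.D η ν) (etaT₁ V c.D η ν) (etaT₂ V c.D η ν') (etaT₃ V c.D η ν') 2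
            (HodgeCM.Adelic.regimeEquiv L V.Hm hV
              (UnitaryGroup.archToAdelic (↥(maximalRealSubfield L)) L (IsCMField.complexConj L) 3 V.Hm a), 1)
            (piSchwartzBruhatEquiv (↥(maximalRealSubfield L)) (Fin 3) (Φarch ℓ ⊗ₜ[ℂ] Φf)) =
          piSchwartzBruhatEquiv (↥(maximalRealSubfield L)) (Fin 3) (Φarch ℓ ⊗ₜ[ℂ] Φf))
    (χ : PontryaginDual (↥(relNormOneIdeles (↥(maximalRealSubfield L)) L) ⧸ relNormOneRat (↥(maximalRealSubfield L)) L)) :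
    Function.Surjective
      (dictEquivTwoCanonicalT' V c hGR hGR₀ hGR₁ hGR₂ hGR₃ η hη hηc ν hν hνc ν' hν' hν'c h₁W hV AT' Φarch harm hdef χ) :=
  (dictEquivTwoCanonicalT' V c hGR hGR₀ hGR₁ hGR₂ hGR₃ η hη hηc ν hν hνc ν' hν' hν'c h₁W hV AT' Φarch harm hdef χ).surjective

include hη hηc hν'c h₁W in
/-- **`χ″₂(η₂', χ)` IS A `GoodChar` OF THE TWISTED SLOT-2 RECORD AT THE R2 PIN** modulo the one archimedean identity `hχinf`. -/
theorem isAutChar_charTwoDictG_T'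
    (χ : PontryaginDual (↥(relNormOneIdeles (↥(maximalRealSubfield L)) L) ⧸ relNormOneRat (↥(maximalRealSubfield L)) L))
    (hχinf : ∀ t : ↥(relNormOneInfUnits (↥(maximalRealSubfield L)) L),
      ((χ (QuotientGroup.mk (relNormOneInfToIdeles (↥(maximalRealSubfield L)) L t)) : Circle) : ℂ) *
          ((torusScalar_twoG V c.D hGR hGR₂ hGR₃ (etaT₂ V c.D η ν')
            ((cmAdelicOneEquivRelNormOne (L : Type)).symm (relNormOneInfToIdeles (↥(maximalRealSubfield L)) L t)) : ℂˣ) : ℂ) =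
        ((adelicCharTwoG V c hGR hGR₂ hGR₃ (etaT₂ V c.D η ν') (CMCenter (L : Type) (frameD V)
            ((cmAdelicOneEquivRelNormOne (L : Type)).symm (relNormOneInfToIdeles (↥(maximalRealSubfield L)) L t))) : ℂˣ) : ℂ)) :
    (splitLineTwoTwistedG V c hGR hGR₂ hGR₃ (etaT₂ V c.D η ν') (etaT₂_V_rat V c η hη ν' hν')).IsAutChar (charTwoDictG V c hGR hGR₂ hGR₃ (etaT₂ V c.D η ν') χ) :=
  isAutChar_charTwoDictG V c hGR hGR₂ hGR₃ (etaT₂ V c.D η ν') (continuous_etaT₂ V c.D η ν' hηc hν'c) (etaT₂_V_rat V c η hη ν' hν') (etaT₂_W_rat V c η hη ν' hν') h₁W χ hχinf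

/-- **SLOT 3 AT THE R2 PIN, CANONICAL FORM**: `Ω(splitLineThree ⊗ ĉ₃(η₃'), χ″₃) ≃ₗ[ℂ[U(V)(𝔸_f)]] Ω₃(χ)` at the #1263 datum
`thetaDistDatumThreeOfT'`. -/
def dictEquivThreeCanonicalT' (Φarch : Module.Dual ℂ (Fin 2 → ℂ) →ₗ[ℂ] 𝓢((Fin 3 → mixedSpace (↥(maximalRealSubfield L))), ℂ))
    (harm : ∀ (u : ↥(stabilizer U21 x₀)) (ℓ : Module.Dual ℂ (Fin 2 → ℂ)),
      lineOmega_three V c.D hGR hGR₂ hGR₃ (etaT₃ V c.D η ν') (u : U21) (Φarch ℓ) =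
        Φarch ((BallForms.isPullbackCocycle_cotangentCocycle.weightOf x₀).dual u ℓ))
    (hdef : ∀ a : UnitaryGroup.arch (↥(maximalRealSubfield L)) L (IsCMField.complexConj L) 3 V.Hm,
      UnitaryGroup.archAt (↥(maximalRealSubfield L)) L (IsCMField.complexConj L) 3 V.Hm (UnitaryGroup.cmPlace (L : Type) ι₁)
          (NumberField.complexConj_smul_infinitePlace (L : Type) _) (IsCMField.complexConj_ne_one (L : Type)) a = 1 →
      ∀ (ℓ : Module.Dual ℂ (Fin 2 → ℂ)) (Φf : FinSB (↥(maximalRealSubfield L)) (Fin 3)),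
        lineRepOf V c.D hGR hGR₀ hGR₁ hGR₂ hGR₃ (etaT₀ V c.D η ν) (etaT₁ V c.D η ν) (etaT₂ V c.D η ν') (etaT₃ V c.D η ν') 3
            (HodgeCM.Adelic.regimeEquiv L V.Hm hV
              (UnitaryGroup.archToAdelic (↥(maximalRealSubfield L)) L (IsCMField.complexConj L) 3 V.Hm a), 1)
            (piSchwartzBruhatEquiv (↥(maximalRealSubfield L)) (Fin 3) (Φarch ℓ ⊗ₜ[ℂ] Φf)) =
          piSchwartzBruhatEquiv (↥(maximalRealSubfield L)) (Fin 3) (Φarch ℓ ⊗ₜ[ℂ] Φf))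
    (χ : PontryaginDual (↥(relNormOneIdeles (↥(maximalRealSubfield L)) L) ⧸ relNormOneRat (↥(maximalRealSubfield L)) L)) :
    (splitLineThreeTwistedG V c hGR hGR₂ hGR₃ (etaT₃ V c.D η ν') (etaT₃_V_rat V c η ν' hν')).Ω
        (finFrameCongr (L : Type) V.Hm (frameG V) (frameD V) (frame_congr V)) (charThreeDictG V c hGR hGR₂ hGR₃ (etaT₃ V c.D η ν') χ) ≃ₗ[adelicAlgebra V]
      ((thetaDistDatumThreeOfT' V c hGR hGR₀ hGR₁ hGR₂ hGR₃ h₁W hV η hη hηc ν hν hνc ν' hν' hν'c AT' Φarch harm hdef).coinvRep χ).asModule :=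
  dictEquivThreeCanonicalG V c (archSideOfT' V c hGR hGR₀ hGR₁ hGR₂ hGR₃ η hη hηc ν hν hνc ν' hν' hν'c h₁W AT') hGR hGR₀ hGR₁ hGR₂ hGR₃ (etaT₀ V c.D η ν) (etaT₁ V c.D η ν) (etaT₂ V c.D η ν') (etaT₃ V c.D η ν') rfl hV rfl (continuous_etaT₃ V c.D η ν' hηc hν'c) (etaT₃_V_rat V c η ν' hν') Φarch harm hdef χ

/-- hence the surjection binder-2's block socket consumes, slot 3, pin R2. -/
theorem dictEquivThreeCanonicalT'_surjective (Φarch : Module.Dual ℂ (Fin 2 → ℂ) →ₗ[ℂ] 𝓢((Fin 3 → mixedSpace (↥(maximalRealSubfield L))), ℂ))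
    (harm : ∀ (u : ↥(stabilizer U21 x₀)) (ℓ : Module.Dual ℂ (Fin 2 → ℂ)),
      lineOmega_three V c.D hGR hGR₂ hGR₃ (etaT₃ V c.D η ν') (u : U21) (Φarch ℓ) =
        Φarch ((BallForms.isPullbackCocycle_cotangentCocycle.weightOf x₀).dual u ℓ))
    (hdef : ∀ a : UnitaryGroup.arch (↥(maximalRealSubfield L)) L (IsCMField.complexConj L) 3 V.Hm,
      UnitaryGroup.archAt (↥(maximalRealSubfield L)) L (IsCMField.complexConj L) 3 V.Hm (UnitaryGroup.cmPlace (L : Type) ι₁)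
          (NumberField.complexConj_smul_infinitePlace (L : Type) _) (IsCMField.complexConj_ne_one (L : Type)) a = 1 →
      ∀ (ℓ : Module.Dual ℂ (Fin 2 → ℂ)) (Φf : FinSB (↥(maximalRealSubfield L)) (Fin 3)),
        lineRepOf V c.D hGR hGR₀ hGR₁ hGR₂ hGR₃ (etaT₀ V c.D η ν) (etaT₁ V c.D η ν) (etaT₂ V c.D η ν') (etaT₃ V c.D η ν') 3
            (HodgeCM.Adelic.regimeEquiv L V.Hm hV
              (UnitaryGroup.archToAdelic (↥(maximalRealSubfield L)) L (IsCMField.complexConj L) 3 V.Hm a), 1)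
            (piSchwartzBruhatEquiv (↥(maximalRealSubfield L)) (Fin 3) (Φarch ℓ ⊗ₜ[ℂ] Φf)) =
          piSchwartzBruhatEquiv (↥(maximalRealSubfield L)) (Fin 3) (Φarch ℓ ⊗ₜ[ℂ] Φf))
    (χ : PontryaginDual (↥(relNormOneIdeles (↥(maximalRealSubfield L)) L) ⧸ relNormOneRat (↥(maximalRealSubfield L)) L)) :
    Function.Surjective
      (dictEquivThreeCanonicalT' V c hGR hGR₀ hGR₁ hGR₂ hGR₃ η hη hηc ν hν hνc ν' hν' hν'c h₁W hV AT' Φarch harm hdef χ) :=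
  (dictEquivThreeCanonicalT' V c hGR hGR₀ hGR₁ hGR₂ hGR₃ η hη hηc ν hν hνc ν' hν' hν'c h₁W hV AT' Φarch harm hdef χ).surjective

include hη hηc hν'c h₁W in
/-- **`χ″₃(η₃', χ)` IS A `GoodChar` OF THE TWISTED SLOT-3 RECORD AT THE R2 PIN** modulo the one archimedean identity `hχinf`. -/
theorem isAutChar_charThreeDictG_T'
    (χ : PontryaginDual (↥(relNormOneIdeles (↥(maximalRealSubfield L)) L) ⧸ relNormOneRat (↥(maximalRealSubfield L)) L))
    (hχinf : ∀ t : ↥(relNormOneInfUnits (↥(maximalRealSubfield L)) L),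
      ((χ (QuotientGroup.mk (relNormOneInfToIdeles (↥(maximalRealSubfield L)) L t)) : Circle) : ℂ) *
          ((torusScalar_threeG V c.D hGR hGR₂ hGR₃ (etaT₃ V c.D η ν')
            ((cmAdelicOneEquivRelNormOne (L : Type)).symm (relNormOneInfToIdeles (↥(maximalRealSubfield L)) L t)) : ℂˣ) : ℂ) =
        ((adelicCharThree V c hGR hGR₂ hGR₃ (etaT₃ V c.D η ν') (CMCenter (L : Type) (frameD V)
            ((cmAdelicOneEquivRelNormOne (L : Type)).symm (relNormOneInfToIdeles (↥(maximalRealSubfield L)) L t))) : ℂˣ) : ℂ)) :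
    (splitLineThreeTwistedG V c hGR hGR₂ hGR₃ (etaT₃ V c.D η ν') (etaT₃_V_rat V c η ν' hν')).IsAutChar (charThreeDictG V c hGR hGR₂ hGR₃ (etaT₃ V c.D η ν') χ) :=
  isAutChar_charThreeDictG V c hGR hGR₂ hGR₃ (etaT₃ V c.D η ν') (continuous_etaT₃ V c.D η ν' hηc hν'c) (etaT₃_V_rat V c η ν' hν') (etaT₃_W_rat V c η hη ν' hν') h₁W χ hχinf

end Pin

end ThetaAdelicSide
end HodgeCM.Model

end
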